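import Summits.KontsevichZagierPeriods.KontsevichZagierPeriods.Theorems.KzOnePeriodsG2SOvals
import Literature.NumberTheory.Transcendental.CurvePeriodsContinuousHomotopyProofs

/-!
# G2S derivations, part 6: two loops around the same real oval have the same symbol

Sub-problem `KzOnePeriods` (Huber–Wüstholz [cite: HuberWustholz2022, Thm 13.3 (2) (p. 121)]): the
`ℚ̄`-linear relations between 1-periods are generated by (R1) bilinearity, (R2) forms vanishing on the
curve, (R3) exactness, (R4) functoriality and (R5) homotopy.  Parts 4–5 read the CM relation of the
`j = 1728` factor of kz1p's curve `C₆` on `C₆` itself, on the explicit `cos/sin` ovals of part 5.  kz1p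
states its G2S relations on the FACTOR symbols `∫_{ε_j} dX/2Y` of the elliptic curves `E′_k`
(`ε_j` = the cycle over a 2-torsion interval), and reduces the `C`-periods to them along
`φ_s = (x² + s, y)`; the lift of an `E`-oval through `φ_s` is an oval of `C` with ANOTHER parametrisation
(`x = √(X − s)`).  To compare two parametrisations of one oval one needs the (R5) lemma of this file:

* `span_sub_of_ovalLoops` — **two loops around the same real oval have the same symbol modulo the
  elementary relations.**  Setting: a smooth affine curve `Z`, a continuous chart `pt : ℝ² → ℂⁿ` and a
  continuous `g : ℝ → ℝ`, `g ≥ 0` on `[lo, hi]`, with `pt(u, y) ∈ Z` whenever `u ∈ [lo, hi]` and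
  `y² = g(u)` (e.g. `pt(u, y) = (u, y)` on `y² = f(x)`, or `(u, i·y)` on `y² = −f(x)`); two `C¹` paths
  `γ_k = pt(X_k, Y_k)` on `[0, 1]` (`k = 0, 1`) with `X_k ∈ [lo, hi]`, `Y_k² = g(X_k)`, the same end
  points `X₀ = X₁` at `t = 0, 1`, the same branch point `X₀(½) = X₁(½)`, `g(X₀(½)) = 0`, at `t = ½`, and
  the same sheets: `κ_k Y_k ≥ 0` on `[0, ½]`, `κ_k Y_k ≤ 0` on `[½, 1]`, `κ₀κ₁ > 0`.  The homotopy is the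
  straight line in the coordinate `u`, `u_s = (1 − s)X₀ + sX₁ ∈ [lo, hi]`, followed on the sheet
  `y = ±√g(u_s)` (sign switched at `t = ½`, where `√g(u_s(½)) = 0`): continuous, NOT `C¹` at the branch
  points — which the tree's continuous form of (R5) (`span_single_sub_single_of_continuousHomotopy`:
  uniform approximation by `C¹` triangles inside a tubular neighbourhood) allows.
* `period_eq_of_ovalLoops` — hence the two periods are equal;
* `sin_sheet_pattern` (the sheets of `y = κ sin 2πt · S`, `S ≥ 0`: part 5's ovals) and `sign_normalise`.

Part 7 (`KzOnePeriodsG2SFactorOvals`) builds the ovals of `E_{A,B}` and their lifts through `φ_s` and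
derives `∫_{ε} dX/Y = 4·∫_{c} x dx/2y` for every pair of such loops.  No definitions, no new axioms, no
statement of the programme cited.
-/

noncomputable section

open MvPolynomial Set Complex Filter Topology
open Literature.NumberTheory.Transcendental Literature.NumberTheory.Transcendental.CurvePeriods

namespace Summit.KontsevichZagierPeriods.KzOnePeriods.G2SDerivation

local notation3 "InSpanRel " c:arg => ∃ (k : ℕ) (ρ : Fin k → (PeriodSymbol →₀ ℂ))
  (a : Fin k → ℂ), (∀ l, IsElementaryRelation (ρ l)) ∧ (∀ l, IsAlgebraic ℚ (a l)) ∧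
    c = ∑ l, a l • ρ l

/-- The symbol `(Z, ω, γ)` as an element of the formal period space. -/
local notation3 (prettyPrint := false) "Sy[" Z ", " hZ ", " ω ", " h ", " γ "]" =>
  (Finsupp.single (⟨Z, hZ, ω, h, γ⟩ : PeriodSymbol) (1 : ℂ) : PeriodSymbol →₀ ℂ)

/-- The period `∫_γ ω` of the symbol `(Z, ω, γ)`. -/
local notation3 (prettyPrint := false) "Pe[" Z ", " hZ ", " ω ", " h ", " γ "]" =>
  PeriodSymbol.period (⟨Z, hZ, ω, h, γ⟩ : PeriodSymbol)

/-! ### Sheets and signs -/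

/-- **The sheets of a `sin`-oval.**  If `y(t) = κ sin 2πt · S(t)` with `S ≥ 0`, then `κ y ≥ 0` for
`t ≤ ½` and `κ y ≤ 0` for `t ≥ ½` (`t ∈ [0, 1]`). -/
theorem sin_sheet_pattern {κ : ℝ} {S y : ℝ → ℝ} (hS : ∀ t, 0 ≤ S t)
    (hy : ∀ t, y t = κ * Real.sin (2 * Real.pi * t) * S t) :
    ∀ t ∈ Icc (0 : ℝ) 1, (t ≤ 1 / 2 → 0 ≤ κ * y t) ∧ (1 / 2 ≤ t → κ * y t ≤ 0) := by
  intro t ht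
  have hκy : κ * y t = κ * κ * S t * Real.sin (2 * Real.pi * t) := by rw [hy]; ring
  have hP : 0 ≤ κ * κ * S t := mul_nonneg (mul_self_nonneg κ) (hS t)
  rw [hκy]
  refine ⟨fun h2 => mul_nonneg hP (Real.sin_nonneg_of_nonneg_of_le_pi
    (by nlinarith [Real.pi_pos, ht.1]) (by nlinarith [Real.pi_pos])), fun h2 => ?_⟩
  have hsin : Real.sin (2 * Real.pi * t) ≤ 0 := by
    rw [← Real.sin_sub_two_pi]
    exact Real.sin_nonpos_of_nonpos_of_neg_pi_le (by nlinarith [Real.pi_pos, ht.2])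
      (by nlinarith [Real.pi_pos])
  nlinarith

/-- **Sign bookkeeping.**  Two multipliers of the same sign define the same sheets, given by one sign
`ε = ±1`. -/
theorem sign_normalise {κ₀ κ₁ : ℝ} (h : 0 < κ₀ * κ₁) :
    ∃ ε : ℝ, (ε = 1 ∨ ε = -1) ∧
      (∀ y : ℝ, (0 ≤ κ₀ * y → 0 ≤ ε * y) ∧ (κ₀ * y ≤ 0 → ε * y ≤ 0)) ∧
      (∀ y : ℝ, (0 ≤ κ₁ * y → 0 ≤ ε * y) ∧ (κ₁ * y ≤ 0 → ε * y ≤ 0)) := by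
  rcases pos_and_pos_or_neg_and_neg_of_mul_pos h with ⟨h0, h1⟩ | ⟨h0, h1⟩
  · refine ⟨1, Or.inl rfl, fun y => ⟨fun hy => ?_, fun hy => ?_⟩, fun y => ⟨fun hy => ?_, fun hy => ?_⟩⟩
    all_goals nlinarith
  · refine ⟨-1, Or.inr rfl, fun y => ⟨fun hy => ?_, fun hy => ?_⟩, fun y => ⟨fun hy => ?_, fun hy => ?_⟩⟩
    all_goals nlinarith

/-! ### The (R5) lemma -/

/-- **Two loops around the same real oval have the same symbol.**  See the module docstring: the
homotopy `H(s, t) = pt(u_s(t), ±√g(u_s(t)))`, `u_s = (1 − s)X₀ + sX₁`, is continuous on the unit square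
with values in `Z`, has fixed end points, and joins `γ₀ = pt(X₀, Y₀)` to `γ₁ = pt(X₁, Y₁)`; the common
sheet `Y_k = ±√g(X_k)` (sign `ε` on `[0, ½]`, `−ε` on `[½, 1]`) is forced by `Y_k² = g(X_k)` and the sign
conditions.  [cite: HuberWustholz2022, §3.3.1 (pp. 42–44)] -/
theorem span_sub_of_ovalLoops {Z : CurveData} (hZ : Z.IsSmoothAffineCurve)
    (ω : Fin Z.n → MvPolynomial (Fin Z.n) ℂ) (h : ∀ i, HasAlgCoeffs (ω i))
    (pt : ℝ → ℝ → (Fin Z.n → ℂ)) (hpt : Continuous fun p : ℝ × ℝ => pt p.1 p.2)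
    {g : ℝ → ℝ} (hg : Continuous g) {lo hi : ℝ} (hg0 : ∀ u ∈ Icc lo hi, 0 ≤ g u)
    (hmem : ∀ u ∈ Icc lo hi, ∀ y : ℝ, y ^ 2 = g u → pt u y ∈ Z.points)
    {κ₀ κ₁ : ℝ} (hκ : 0 < κ₀ * κ₁) {X₀ Y₀ X₁ Y₁ : ℝ → ℝ}
    (hX₀ : ContinuousOn X₀ (Icc 0 1)) (hX₁ : ContinuousOn X₁ (Icc 0 1))
    (hb₀ : ∀ t ∈ Icc (0 : ℝ) 1, X₀ t ∈ Icc lo hi) (hb₁ : ∀ t ∈ Icc (0 : ℝ) 1, X₁ t ∈ Icc lo hi)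
    (hq₀ : ∀ t ∈ Icc (0 : ℝ) 1, Y₀ t ^ 2 = g (X₀ t))
    (hq₁ : ∀ t ∈ Icc (0 : ℝ) 1, Y₁ t ^ 2 = g (X₁ t))
    (hs₀ : ∀ t ∈ Icc (0 : ℝ) 1, (t ≤ 1 / 2 → 0 ≤ κ₀ * Y₀ t) ∧ (1 / 2 ≤ t → κ₀ * Y₀ t ≤ 0))
    (hs₁ : ∀ t ∈ Icc (0 : ℝ) 1, (t ≤ 1 / 2 → 0 ≤ κ₁ * Y₁ t) ∧ (1 / 2 ≤ t → κ₁ * Y₁ t ≤ 0))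
    (h0 : X₁ 0 = X₀ 0) (h1 : X₁ 1 = X₀ 1) (hm : X₁ (1 / 2) = X₀ (1 / 2))
    (hgm : g (X₀ (1 / 2)) = 0) (γ₀ γ₁ : CurvePath Z)
    (hγ₀ : ∀ t ∈ Icc (0 : ℝ) 1, γ₀.toFun t = pt (X₀ t) (Y₀ t))
    (hγ₁ : ∀ t ∈ Icc (0 : ℝ) 1, γ₁.toFun t = pt (X₁ t) (Y₁ t)) :
    InSpanRel (Sy[Z, hZ, ω, h, γ₀] - Sy[Z, hZ, ω, h, γ₁]) := by
  obtain ⟨ε, hε, hε₀, hε₁⟩ := sign_normalise hκ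
  have hε2 : ε ^ 2 = 1 := by rcases hε with rfl | rfl <;> norm_num
  -- the common sheet
  have key : ∀ {X Y : ℝ → ℝ}, (∀ t ∈ Icc (0 : ℝ) 1, Y t ^ 2 = g (X t)) →
      (∀ t ∈ Icc (0 : ℝ) 1, (t ≤ 1 / 2 → 0 ≤ ε * Y t) ∧ (1 / 2 ≤ t → ε * Y t ≤ 0)) →
      ∀ t ∈ Icc (0 : ℝ) 1,
        Y t = if t ≤ 1 / 2 then ε * √(g (X t)) else -ε * √(g (X t)) := by
    intro X Y hq hs t ht
    have hq2 : (ε * Y t) ^ 2 = g (X t) := by rw [mul_pow, hε2, one_mul, hq t ht]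
    have hY : Y t = ε * (ε * Y t) := by rw [← mul_assoc, ← sq, hε2, one_mul]
    split_ifs with hle
    · calc Y t = ε * (ε * Y t) := hY
        _ = ε * √((ε * Y t) ^ 2) := by rw [Real.sqrt_sq ((hs t ht).1 hle)]
        _ = ε * √(g (X t)) := by rw [hq2]
    · have hle' : 1 / 2 ≤ t := (not_le.1 hle).le
      calc Y t = ε * (ε * Y t) := hY
        _ = ε * -√((-(ε * Y t)) ^ 2) := by
          rw [Real.sqrt_sq (neg_nonneg.2 ((hs t ht).2 hle')), neg_neg]
        _ = -ε * √(g (X t)) := by rw [neg_sq, hq2]; ring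
  have hY₀ := key hq₀ fun t ht => ⟨fun h' => (hε₀ _).1 ((hs₀ t ht).1 h'),
    fun h' => (hε₀ _).2 ((hs₀ t ht).2 h')⟩
  have hY₁ := key hq₁ fun t ht => ⟨fun h' => (hε₁ _).1 ((hs₁ t ht).1 h'),
    fun h' => (hε₁ _).2 ((hs₁ t ht).2 h')⟩
  -- the homotopy
  obtain ⟨U, hU⟩ : ∃ U : ℝ × ℝ → ℝ, ∀ p, U p = (1 - p.1) * X₀ p.2 + p.1 * X₁ p.2 :=
    ⟨_, fun _ => rfl⟩
  obtain ⟨Br, hBr⟩ : ∃ Br : ℝ × ℝ → ℝ,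
      ∀ p, Br p = if p.2 ≤ 1 / 2 then ε * √(g (U p)) else -ε * √(g (U p)) := ⟨_, fun _ => rfl⟩
  obtain ⟨H, hH⟩ : ∃ H : ℝ × ℝ → (Fin Z.n → ℂ), ∀ p, H p = pt (U p) (Br p) := ⟨_, fun _ => rfl⟩
  have hUS : ∀ p ∈ Icc (0 : ℝ) 1 ×ˢ Icc (0 : ℝ) 1, U p ∈ Icc lo hi := by
    intro p hp
    obtain ⟨⟨hs0, hs1⟩, ht⟩ := Set.mem_prod.1 hp
    obtain ⟨hl0, hu0⟩ := hb₀ p.2 ht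
    obtain ⟨hl1, hu1⟩ := hb₁ p.2 ht
    rw [hU]
    constructor
    · nlinarith [mul_nonneg (sub_nonneg.2 hs1) (sub_nonneg.2 hl0),
        mul_nonneg hs0 (sub_nonneg.2 hl1)]
    · nlinarith [mul_nonneg (sub_nonneg.2 hs1) (sub_nonneg.2 hu0),
        mul_nonneg hs0 (sub_nonneg.2 hu1)]
  have hmaps : MapsTo (fun p : ℝ × ℝ => p.2) (Icc (0 : ℝ) 1 ×ˢ Icc (0 : ℝ) 1) (Icc (0 : ℝ) 1) :=
    fun p hp => (Set.mem_prod.1 hp).2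
  have hUc : ContinuousOn U (Icc (0 : ℝ) 1 ×ˢ Icc (0 : ℝ) 1) := by
    rw [show U = fun p => (1 - p.1) * X₀ p.2 + p.1 * X₁ p.2 from funext hU]
    exact ((continuousOn_const.sub continuousOn_fst).mul (hX₀.comp continuousOn_snd hmaps)).add
      (continuousOn_fst.mul (hX₁.comp continuousOn_snd hmaps))
  have hRc : ContinuousOn (fun p => √(g (U p))) (Icc (0 : ℝ) 1 ×ˢ Icc (0 : ℝ) 1) :=
    (hg.comp_continuousOn hUc).sqrt
  have hBc : ContinuousOn Br (Icc (0 : ℝ) 1 ×ˢ Icc (0 : ℝ) 1) := by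
    rw [show Br = fun p => if p.2 ≤ 1 / 2 then ε * √(g (U p)) else -ε * √(g (U p)) from
      funext hBr]
    refine ContinuousOn.if ?_ ?_ ?_
    · rintro p ⟨-, hfr⟩
      have h2 : p.2 = 1 / 2 := frontier_le_subset_eq continuous_snd continuous_const hfr
      have hUp : U p = X₀ (1 / 2) := by rw [hU, h2, hm]; ring
      rw [hUp, hgm, Real.sqrt_zero, mul_zero, mul_zero]
    · exact (continuousOn_const.mul hRc).mono inter_subset_left
    · exact (continuousOn_const.mul hRc).mono inter_subset_left
  have hB2 : ∀ p ∈ Icc (0 : ℝ) 1 ×ˢ Icc (0 : ℝ) 1, Br p ^ 2 = g (U p) := by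
    intro p hp
    have hR2 : √(g (U p)) ^ 2 = g (U p) := Real.sq_sqrt (hg0 _ (hUS p hp))
    rw [hBr]
    split_ifs
    · rw [mul_pow, hε2, one_mul, hR2]
    · rw [mul_pow, neg_sq, hε2, one_mul, hR2]
  have hHc : ContinuousOn H (Icc (0 : ℝ) 1 ×ˢ Icc (0 : ℝ) 1) := by
    rw [show H = (fun q : ℝ × ℝ => pt q.1 q.2) ∘ fun p => (U p, Br p) from funext hH]
    exact hpt.comp_continuousOn (hUc.prodMk hBc)
  have hHZ : ∀ p ∈ Icc (0 : ℝ) 1 ×ˢ Icc (0 : ℝ) 1, H p ∈ Z.points := fun p hp => by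
    rw [hH]
    exact hmem _ (hUS p hp) _ (hB2 p hp)
  -- edges of the square
  have hU0 : ∀ s, U (s, 0) = X₀ 0 := fun s => by simp only [hU, h0]; ring
  have hU1 : ∀ s, U (s, 1) = X₀ 1 := fun s => by simp only [hU, h1]; ring
  have hUl : ∀ t, U (0, t) = X₀ t := fun t => by simp only [hU]; ring
  have hUr : ∀ t, U (1, t) = X₁ t := fun t => by simp only [hU]; ring
  have hBl : ∀ t ∈ Icc (0 : ℝ) 1, Br (0, t) = Y₀ t := fun t ht => by
    rw [hBr, hY₀ t ht]
    simp only [hUl]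
  have hBr' : ∀ t ∈ Icc (0 : ℝ) 1, Br (1, t) = Y₁ t := fun t ht => by
    rw [hBr, hY₁ t ht]
    simp only [hUr]
  refine span_single_sub_single_of_continuousHomotopy hZ ω h H hHc hHZ (fun s _ => ?_)
    (fun s _ => ?_) γ₀ γ₁ (fun t ht => ?_) (fun t ht => ?_)
  · simp only [hH, hBr, hU0]
  · simp only [hH, hBr, hU1]
  · rw [hγ₀ t ht, hH, hUl, hBl t ht]
  · rw [hγ₁ t ht, hH, hUr, hBr' t ht]

/-- … **hence the two periods are equal.** -/
theorem period_eq_of_ovalLoops {Z : CurveData} (hZ : Z.IsSmoothAffineCurve)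
    (ω : Fin Z.n → MvPolynomial (Fin Z.n) ℂ) (h : ∀ i, HasAlgCoeffs (ω i))
    (pt : ℝ → ℝ → (Fin Z.n → ℂ)) (hpt : Continuous fun p : ℝ × ℝ => pt p.1 p.2)
    {g : ℝ → ℝ} (hg : Continuous g) {lo hi : ℝ} (hg0 : ∀ u ∈ Icc lo hi, 0 ≤ g u)
    (hmem : ∀ u ∈ Icc lo hi, ∀ y : ℝ, y ^ 2 = g u → pt u y ∈ Z.points)
    {κ₀ κ₁ : ℝ} (hκ : 0 < κ₀ * κ₁) {X₀ Y₀ X₁ Y₁ : ℝ → ℝ}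
    (hX₀ : ContinuousOn X₀ (Icc 0 1)) (hX₁ : ContinuousOn X₁ (Icc 0 1))
    (hb₀ : ∀ t ∈ Icc (0 : ℝ) 1, X₀ t ∈ Icc lo hi) (hb₁ : ∀ t ∈ Icc (0 : ℝ) 1, X₁ t ∈ Icc lo hi)
    (hq₀ : ∀ t ∈ Icc (0 : ℝ) 1, Y₀ t ^ 2 = g (X₀ t))
    (hq₁ : ∀ t ∈ Icc (0 : ℝ) 1, Y₁ t ^ 2 = g (X₁ t))
    (hs₀ : ∀ t ∈ Icc (0 : ℝ) 1, (t ≤ 1 / 2 → 0 ≤ κ₀ * Y₀ t) ∧ (1 / 2 ≤ t → κ₀ * Y₀ t ≤ 0))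
    (hs₁ : ∀ t ∈ Icc (0 : ℝ) 1, (t ≤ 1 / 2 → 0 ≤ κ₁ * Y₁ t) ∧ (1 / 2 ≤ t → κ₁ * Y₁ t ≤ 0))
    (h0 : X₁ 0 = X₀ 0) (h1 : X₁ 1 = X₀ 1) (hm : X₁ (1 / 2) = X₀ (1 / 2))
    (hgm : g (X₀ (1 / 2)) = 0) (γ₀ γ₁ : CurvePath Z)
    (hγ₀ : ∀ t ∈ Icc (0 : ℝ) 1, γ₀.toFun t = pt (X₀ t) (Y₀ t))
    (hγ₁ : ∀ t ∈ Icc (0 : ℝ) 1, γ₁.toFun t = pt (X₁ t) (Y₁ t)) :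
    Pe[Z, hZ, ω, h, γ₀] = Pe[Z, hZ, ω, h, γ₁] := by
  obtain ⟨k, ρ, w, hρ, hw, hc⟩ := span_sub_of_ovalLoops hZ ω h pt hpt hg hg0 hmem hκ hX₀ hX₁ hb₀ hb₁
    hq₀ hq₁ hs₀ hs₁ h0 h1 hm hgm γ₀ γ₁ hγ₀ hγ₁
  have h0' := evalCombination_eq_zero_of_isElementaryRelation ρ w hρ
  rw [← hc, sub_eq_add_neg, ← neg_one_smul ℂ, evalCombination_add, evalCombination_smul,
    evalCombination_single, evalCombination_single] at h0'
  linear_combination h0'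

end Summit.KontsevichZagierPeriods.KzOnePeriods.G2SDerivation

end
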